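import Summits.ResolutionOfSingularities.ResolutionOfSingularities.Theorems.FrobeniusClosingPatchingRelPerfectDepthMixedTargetsB
import Summits.ResolutionOfSingularities.ResolutionOfSingularities.Theorems.FrobeniusClosingPatchingRelPerfectMonomialSumLocalPair
import HarnessLib

/-!
# Crux `PatchingRelPerfect` (stmt-ResolutionOfSingularities-16161), chain W5.2 — TargetsF5 T5-M CLOSED BY NAME:
# `localPairGame_holds : DepthTargets.LocalPairGame`

[OURS · L1 W5.2 · rung tool] res-L1-w52-plan-1 g7 STEER (TargetsF5) 2026-08-27T07:30:46Z «stub-1 = `localPairGame_holds :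
LocalPairGame` over p509147 + p504028»: the S-TARGET T5-M of `…DepthMixedTargetsB.lean` (the monomial pair game with
the snc boundary asked only on an open `U ⊇ cosupp`) is the case `j = U.ι`, `𝒦 = [A, B]` of
`monomialSumPrincipalization_local_pair` (`…MonomialSumLocalPair.lean`: stub-4's pair game p504028 on `U`, extended
by `CentreSeqExtend.exists_centreSeq_of_open`, p509147). Fact-free; nothing here is a statement of the manuscript under
review.

## References

* J. Kollár, *Lectures on Resolution of Singularities* (2007), (3.111) Step 3. [Kollar2007]
* U. Görtz, T. Wedhorn, *Algebraic Geometry I*, 2nd ed. (2020), Prop. 13.91 (1)–(2). [GortzWedhorn2020]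
-/

-- `Summit.<Summit>.<Sub>.Theorems` with `Sub = Summit` (single-conjunct summit, D-0017)
set_option linter.dupNamespace false

noncomputable section

open CategoryTheory AlgebraicGeometry TopologicalSpace
open Literature.AlgebraicGeometry.Resolution

namespace Summit.ResolutionOfSingularities.ResolutionOfSingularities.Theorems.DepthTargets

universe u

/-- **T5-M `LocalPairGame` holds** (the pair game on `U`, extended to `X`). [cite: Kollar2007, (3.111) Step 3]
[cite: GortzWedhorn2020, Prop. 13.91 (1)–(2)] -/
theorem localPairGame_holds : LocalPairGame.{u} := by
  intro X _ hX U A B hAB hsnc hsupp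
  haveI : CompactSpace (U : Scheme.{u}) :=
    isCompact_iff_compactSpace.mp (TopologicalSpace.NoetherianSpace.isCompact (U : Set X))
  haveI : IsNoetherian (U : Scheme.{u}) := ⟨⟩
  have h𝒦 : ∀ K ∈ [A, B], boundaryOf K = boundaryOf A := by
    intro K hK
    simp only [List.mem_cons, List.not_mem_nil, or_false] at hK
    rcases hK with rfl | rfl
    · rfl
    · exact hAB.symm
  have hsupp' : ((monomialSum [A, B]).support : Set X) ⊆ Set.range U.ι.base := by
    rw [monomialSum_pair, Scheme.Opens.range_ι]
    exact hsupp
  obtain ⟨s, h1, h2, h3, h4⟩ := monomialSumPrincipalization_local_pair hX U.ι (boundaryOf A) hsnc [A, B] h𝒦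
    (List.cons_ne_nil _ _) (by simp) hsupp'
  rw [monomialSum_pair] at h2 h4
  exact ⟨s, h1, h2, h3, h4⟩

end Summit.ResolutionOfSingularities.ResolutionOfSingularities.Theorems.DepthTargets

end
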